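import Summits.RiemannHypothesis.RiemannHypothesis.Theorems.SoloInformedWeilSurface

/-!
# The located object on the surface side is a Hodge-index certificate (motivic door, cc-3)

Honest framing (cell `pub-rhdoor`): lottery ticket at the motivic door; RH probability negligible;
consolation prizes are real: a new semi-local Weil-positivity theorem, or a located gap in the
Connes–Consani programme, plus the ff-door theorem.  This file has NO arithmetic content beyond the
tree's Weil criterion; it is the kernel form of the surface-side sub-entry of the cell's located gap,
and introduces no definitions.

The Riemann–Roch strategy (Connes–Consani, arXiv:1805.10501 §3.1; essay arXiv:1509.05576 §4) asks for
three things on one real vector space `V` of "divisor classes on the square of `Spec ℤ`":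

* (L) LEFSCHETZ DATA — a symmetric form `I` with two isotropic fibres `e₁·e₂ = 1` and, for every real
  test `g`, a "graph" class `Γ_g = corr g` with `Γ_g·e₁ = Re ĝ(1)`, `Γ_g·e₂ = Re ĝ(0)`,
  `Γ_g·Γ_g = 2 Re ĝ(0) Re ĝ(1) - Re Q(g)` (identities DECREED by the explicit formula);
* (RR₀) a function `h0` with `h0 D + h0 (-D) ≥ ½ D·D - c`;
* (V)  `D·(e₁ + e₂) ≤ 0 → h0 D ≤ B`.

`SoloInformedWeilSurface` proves (L)+(RR₀)+(V) `→ RH` and, under RH, a model on `ℝ³`.  Here the three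
requirements are separated, with the following unconditional outcome (labels PROVED = this file):

1. `exists_h0_riemannRoch`, `exists_h0_vanishing`: on EVERY carrier, (RR₀) alone and (V) alone are
   free (`h0 D = (½ D·D)₊`, resp. `h0 = 0`).
2. `exists_riemannRoch_datum_iff_hodge`: given the fibres, an `h0` with (RR₀) ∧ (V) exists iff the form
   has HODGE INDEX `D·(e₁+e₂) = 0 → D·D ≤ 0`; and then the `ℙ¹ × ℙ¹` section count
   `h0 D = (D·e₁ + 1)₊ (D·e₂ + 1)₊` is always a witness.  So the pair (RR₀, V) carries exactly one bit
   about the carrier — the sign of the form on the primitive classes — and nothing else.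
3. `exists_lefschetz_data_not_hodge`: the Lefschetz data (L) exist UNCONDITIONALLY on the split form
   `U ⊕ U` of signature `(2,2)` (`Γ_g = (Re ĝ(0), Re ĝ(1); 1, -½ Re Q(g))`, identities for every `g`),
   where Hodge index fails; hence no (RR₀, V)-datum exists there (`not_hodge_no_riemannRoch_datum`).
4. `hodge_modelInter`, `exists_riemannRoch_datum_modelInter`: the index-one form `x y' + y x' - z z'`
   on `ℝ³` carries an (RR₀, V)-datum unconditionally, and carries the Lefschetz data (L) iff RH
   (`exists_lefschetz_data_modelInter_iff`).
5. `riemannHypothesis_of_hodge`, `riemannHypothesis_iff_exists_hodge_lefschetz_data`: RH ⟺ some carrier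
   has (L) and Hodge index (already on `ℝ³`).

Reading (DERIVED from 1–5, twin of the cycle-side dichotomy in `MotivicDoorDeningerRealTwist` /
`MotivicDoorDeningerHodgePackage`): one object is asked to satisfy two constraints of opposite sign —
the decreed Lefschetz identities (free in signature `(2,2)`) and Hodge index (free in signature `(1,2)`)
— and their coexistence on one carrier is RH.  The located object of the surface-side sub-entry, "an
`H⁰` with (RR₀) ∧ (V)", is therefore precisely a CERTIFICATE OF HODGE INDEX for the decreed pairing,
as a `θ`-equivariant AND positive `∗` is on the cycle side; Riemann–Roch bookkeeping itself adds
nothing (item 2).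

References: A. Weil (1948); A. Mattuck, J. Tate, Abh. Math. Sem. Hamburg 22 (1958); A. Grothendieck,
J. reine angew. Math. 200 (1958); R. Hartshorne, *Algebraic Geometry* V.1.9, Ex. V.1.9; E. Bombieri,
Rend. Mat. Acc. Lincei (9) 11 (2000) Thm. 2; A. Connes, C. Consani, arXiv:1805.10501 §3.1;
A. Connes, arXiv:1509.05576 §4.
-/

noncomputable section

open Complex Set MeasureTheory Literature.NumberTheory.LFunctions
open scoped ComplexConjugate

namespace Summit.RiemannHypothesis.RiemannHypothesis.Theorems.MotivicDoor.ConnesConsani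

open Summit.RiemannHypothesis.RiemannHypothesis.Theorems

variable {V : Type*} [AddCommGroup V] [Module ℝ V]

/-! ## 1. Either inequality alone is free on every carrier -/

/-- (RR₀) alone is free: for ANY bilinear form, `h0 D := (½ D·D)₊` satisfies the Riemann–Roch
inequality with `c = 0` (no fibres, no positivity needed). -/
theorem exists_h0_riemannRoch (I : LinearMap.BilinForm ℝ V) :
    ∃ h0 : V → ℝ, ∀ D, I D D / 2 - 0 ≤ h0 D + h0 (-D) := by
  refine ⟨fun D ↦ max (I D D / 2) 0, fun D ↦ ?_⟩
  simp only [map_neg, LinearMap.neg_apply, neg_neg]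
  linarith [le_max_left (I D D / 2) 0, le_max_right (I D D / 2) 0]

/-- (V) alone is free: `h0 := 0`, `B := 0`. -/
theorem exists_h0_vanishing (I : LinearMap.BilinForm ℝ V) (H : V) :
    ∃ (h0 : V → ℝ) (B : ℝ), ∀ D, I D H ≤ 0 → h0 D ≤ B :=
  ⟨fun _ ↦ 0, 0, fun _ _ ↦ le_rfl⟩

/-! ## 2. A Riemann–Roch datum exists iff Hodge index holds -/

/-- **(RR₀) ∧ (V) is exactly one bit: Hodge index.**  For a symmetric form with isotropic fibres
`e₁·e₂ = 1`, a function `h0` with the Riemann–Roch inequality AND the vanishing bound exists iff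
`D·(e₁ + e₂) = 0 → D·D ≤ 0`.  (→) is `inter_self_nonpos_of_riemannRoch₀` (Mattuck–Tate shape);
(←): Hodge index gives Castelnuovo–Severi `D·D ≤ 2 (D·e₁)(D·e₂)` (`inter_self_le_two_mul_of_hodge`),
and then the `ℙ¹ × ℙ¹` count `h0 D := (D·e₁ + 1)₊ (D·e₂ + 1)₊` works with `c = 0`, `B = 1`
(`model_riemannRoch`, `model_vanishing`). -/
theorem exists_riemannRoch_datum_iff_hodge (I : LinearMap.BilinForm ℝ V) (hI : ∀ x y, I x y = I y x)
    {e₁ e₂ : V} (h₁ : I e₁ e₁ = 0) (h₂ : I e₂ e₂ = 0) (h₁₂ : I e₁ e₂ = 1) :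
    (∃ (h0 : V → ℝ) (c B : ℝ), (∀ D, I D D / 2 - c ≤ h0 D + h0 (-D)) ∧
        (∀ D, I D (e₁ + e₂) ≤ 0 → h0 D ≤ B)) ↔
      ∀ D, I D (e₁ + e₂) = 0 → I D D ≤ 0 := by
  constructor
  · rintro ⟨h0, c, B, rr, van⟩ D hD
    exact inter_self_nonpos_of_riemannRoch₀ I h0 (e₁ + e₂) c B rr van hD
  · intro hodge
    refine ⟨fun D ↦ max (I D e₁ + 1) 0 * max (I D e₂ + 1) 0, 0, 1, fun D ↦ ?_, fun D hD ↦ ?_⟩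
    · have hcs := inter_self_le_two_mul_of_hodge I hI h₁ h₂ h₁₂ hodge D
      have hm := model_riemannRoch (I D e₁) (I D e₂) 0
      simp only [mul_zero, sub_zero] at hm ⊢
      simp only [map_neg, LinearMap.neg_apply]
      linarith
    · have hD' : I D e₁ + I D e₂ ≤ 0 := by simpa only [map_add] using hD
      exact model_vanishing hD'

/-- Hence: where Hodge index fails, no Riemann–Roch datum exists (although each half does, item 1). -/
theorem not_hodge_no_riemannRoch_datum (I : LinearMap.BilinForm ℝ V) {e₁ e₂ : V}
    (h : ¬ ∀ D, I D (e₁ + e₂) = 0 → I D D ≤ 0) :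
    ¬ ∃ (h0 : V → ℝ) (c B : ℝ), (∀ D, I D D / 2 - c ≤ h0 D + h0 (-D)) ∧
        (∀ D, I D (e₁ + e₂) ≤ 0 → h0 D ≤ B) := fun ⟨h0, c, B, rr, van⟩ ↦
  h fun _ hD ↦ inter_self_nonpos_of_riemannRoch₀ I h0 (e₁ + e₂) c B rr van hD

/-! ## 3. Hodge index on any carrier of the Lefschetz data gives RH -/

/-- **Hodge index on any carrier of the Lefschetz data gives RH.**  Given (L) on `V` — a symmetric
form, isotropic fibres with `e₁·e₂ = 1`, and graph classes `corr g` with the three decreed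
intersection numbers for real tests — the Hodge-index inequality `D·(e₁+e₂) = 0 → D·D ≤ 0` implies the
Riemann Hypothesis: the `h0` of item 2 makes `V` a Weil surface (`WeilSurface.riemannHypothesis`:
Castelnuovo–Severi at `corr g` is `Re Q(g) ≥ 0`, then Weil's criterion, Bombieri 2000 Thm. 2). -/
theorem riemannHypothesis_of_hodge (I : LinearMap.BilinForm ℝ V) (hI : ∀ x y, I x y = I y x)
    {e₁ e₂ : V} (h₁ : I e₁ e₁ = 0) (h₂ : I e₂ e₂ = 0) (h₁₂ : I e₁ e₂ = 1) (corr : (ℝ → ℂ) → V)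
    (hc₁ : ∀ g, IsWeilTest g → (∀ t, conj (g t) = g t) → I (corr g) e₁ = (weilMellin g 1).re)
    (hc₂ : ∀ g, IsWeilTest g → (∀ t, conj (g t) = g t) → I (corr g) e₂ = (weilMellin g 0).re)
    (hcs : ∀ g, IsWeilTest g → (∀ t, conj (g t) = g t) →
      I (corr g) (corr g) = 2 * (weilMellin g 0).re * (weilMellin g 1).re - (weilQuadratic g).re)
    (hodge : ∀ D, I D (e₁ + e₂) = 0 → I D D ≤ 0) : RiemannHypothesis := by
  obtain ⟨h0, c, B, rr, van⟩ := (exists_riemannRoch_datum_iff_hodge I hI h₁ h₂ h₁₂).2 hodge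
  exact WeilSurface.riemannHypothesis
    { inter := I, inter_comm := hI, e₁ := e₁, e₂ := e₂, inter_e₁_e₁ := h₁, inter_e₂_e₂ := h₂,
      inter_e₁_e₂ := h₁₂, corr := corr, inter_corr_e₁ := hc₁, inter_corr_e₂ := hc₂,
      inter_corr_self := hcs, h0 := h0, c := c, B := B, riemannRoch := rr, vanishing := van }

/-! ## 3a. Signature (2,2): the Lefschetz data are free, Hodge index fails -/

/-- **The Lefschetz data exist unconditionally, on a carrier without Hodge index.**  On
`(ℝ × ℝ) × (ℝ × ℝ)` with the split form `U ⊕ U`, `x y' + y x' + z w' + w z'` (signature `(2,2)`),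
fibres `((1,0),(0,0))`, `((0,1),(0,0))` and `corr g := ((Re ĝ(0), Re ĝ(1)), (1, -½ Re Q(g)))`, all
three decreed intersection numbers hold for EVERY `g : ℝ → ℂ` (no test-function hypothesis, no RH),
while `D = ((0,0),(1,1))` is orthogonal to `e₁ + e₂` with `D·D = 2 > 0`. -/
theorem exists_lefschetz_data_not_hodge :
    ∃ (I : LinearMap.BilinForm ℝ ((ℝ × ℝ) × (ℝ × ℝ))) (e₁ e₂ : (ℝ × ℝ) × (ℝ × ℝ))
      (corr : (ℝ → ℂ) → (ℝ × ℝ) × (ℝ × ℝ)),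
      (∀ x y, I x y = I y x) ∧ I e₁ e₁ = 0 ∧ I e₂ e₂ = 0 ∧ I e₁ e₂ = 1 ∧
      (∀ g, I (corr g) e₁ = (weilMellin g 1).re) ∧ (∀ g, I (corr g) e₂ = (weilMellin g 0).re) ∧
      (∀ g, I (corr g) (corr g) = 2 * (weilMellin g 0).re * (weilMellin g 1).re - (weilQuadratic g).re) ∧
      ¬ ∀ D, I D (e₁ + e₂) = 0 → I D D ≤ 0 := by
  let I : LinearMap.BilinForm ℝ ((ℝ × ℝ) × (ℝ × ℝ)) :=
    LinearMap.mk₂ ℝ (fun p q ↦ p.1.1 * q.1.2 + p.1.2 * q.1.1 + p.2.1 * q.2.2 + p.2.2 * q.2.1)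
      (fun p p' q ↦ by simp only [Prod.fst_add, Prod.snd_add]; ring)
      (fun r p q ↦ by simp only [Prod.smul_fst, Prod.smul_snd, smul_eq_mul]; ring)
      (fun p q q' ↦ by simp only [Prod.fst_add, Prod.snd_add]; ring)
      (fun r p q ↦ by simp only [Prod.smul_fst, Prod.smul_snd, smul_eq_mul]; ring)
  have hI : ∀ p q : (ℝ × ℝ) × (ℝ × ℝ),
      I p q = p.1.1 * q.1.2 + p.1.2 * q.1.1 + p.2.1 * q.2.2 + p.2.2 * q.2.1 := fun _ _ ↦ rfl
  refine ⟨I, ((1, 0), (0, 0)), ((0, 1), (0, 0)),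
    fun g ↦ (((weilMellin g 0).re, (weilMellin g 1).re), (1, -((weilQuadratic g).re / 2))),
    fun p q ↦ ?_, ?_, ?_, ?_, fun g ↦ ?_, fun g ↦ ?_, fun g ↦ ?_, fun h ↦ ?_⟩
  · simp only [hI]; ring
  · simp [hI]
  · simp [hI]
  · simp [hI]
  · simp [hI]
  · simp [hI]
  · simp only [hI]; ring
  · have := h ((0, 0), (1, 1)) (by simp [hI])
    norm_num [hI] at this

/-- In particular no Weil surface lives on that carrier (whatever its `corr` and `h0`): with the split
form and those fibres, `WeilSurface.inter_self_nonpos` fails at `((0,0),(1,1))`. -/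
theorem no_weilSurface_on_split_form (X : WeilSurface ((ℝ × ℝ) × (ℝ × ℝ)))
    (hI : ∀ p q, X.inter p q = p.1.1 * q.1.2 + p.1.2 * q.1.1 + p.2.1 * q.2.2 + p.2.2 * q.2.1)
    (h₁ : X.e₁ = ((1, 0), (0, 0))) (h₂ : X.e₂ = ((0, 1), (0, 0))) : False := by
  have h := @WeilSurface.inter_self_nonpos _ _ _ X ((0, 0), (1, 1))
  rw [h₁, h₂, hI, hI] at h
  norm_num at h

/-! ## 3b. Signature (1,2): a Riemann–Roch datum is free, the Lefschetz data are RH -/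

/-- Hodge index HOLDS for the model form `x y' + y x' - z z'` on `ℝ³` (`modelInter`) with fibres
`(1,0,0), (0,1,0)`: `x + y = 0 → 2 x y - z² ≤ 0`. -/
theorem hodge_modelInter (D : ℝ × ℝ × ℝ) (hD : modelInter D ((1, 0, 0) + (0, 1, 0)) = 0) :
    modelInter D D ≤ 0 := by
  have hD' : D.1 + D.2.1 = 0 := by simpa using hD
  have h1 : D.2.1 = -D.1 := by linarith
  simp only [modelInter_apply, h1]
  nlinarith [mul_self_nonneg D.1, mul_self_nonneg D.2.2]

/-- … hence a Riemann–Roch datum exists on the model carrier UNCONDITIONALLY (e.g.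
`h0 = (x+1)₊(y+1)₊`, `c = 0`, `B = 1`, as in `WeilSurface.model`, whose `h0` never used RH). -/
theorem exists_riemannRoch_datum_modelInter :
    ∃ (h0 : ℝ × ℝ × ℝ → ℝ) (c B : ℝ), (∀ D, modelInter D D / 2 - c ≤ h0 D + h0 (-D)) ∧
      (∀ D, modelInter D (((1, 0, 0) : ℝ × ℝ × ℝ) + (0, 1, 0)) ≤ 0 → h0 D ≤ B) :=
  (exists_riemannRoch_datum_iff_hodge modelInter (fun p q ↦ by simp only [modelInter_apply]; ring)
    (by simp) (by simp) (by simp)).2 hodge_modelInter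

/-- **On the index-one carrier the Lefschetz data are exactly RH**: graph classes `corr g ∈ ℝ³` with
the three decreed intersection numbers for the model form and fibres exist iff the Riemann
Hypothesis holds ((←) `WeilSurface.model`, `corr g = (Re ĝ(0), Re ĝ(1), √(Re Q(g)))`, which needs
`Re Q(g) ≥ 0`; (→) `hodge_modelInter` and `riemannHypothesis_of_hodge`). -/
theorem exists_lefschetz_data_modelInter_iff :
    (∃ corr : (ℝ → ℂ) → ℝ × ℝ × ℝ,
      (∀ g, IsWeilTest g → (∀ t, conj (g t) = g t) →
          modelInter (corr g) (1, 0, 0) = (weilMellin g 1).re) ∧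
        (∀ g, IsWeilTest g → (∀ t, conj (g t) = g t) →
          modelInter (corr g) (0, 1, 0) = (weilMellin g 0).re) ∧
        (∀ g, IsWeilTest g → (∀ t, conj (g t) = g t) → modelInter (corr g) (corr g) =
          2 * (weilMellin g 0).re * (weilMellin g 1).re - (weilQuadratic g).re)) ↔
      RiemannHypothesis := by
  constructor
  · rintro ⟨corr, hc₁, hc₂, hcs⟩
    exact riemannHypothesis_of_hodge modelInter (fun p q ↦ by simp only [modelInter_apply]; ring)
      (by simp) (by simp) (by simp) corr hc₁ hc₂ hcs hodge_modelInter
  · intro hRH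
    exact ⟨(WeilSurface.model hRH).corr, (WeilSurface.model hRH).inter_corr_e₁,
      (WeilSurface.model hRH).inter_corr_e₂, (WeilSurface.model hRH).inter_corr_self⟩

/-! ## 4. RH ⟺ the Lefschetz data live on some carrier with Hodge index -/

/-- **RH ⟺ a Hodge-index carrier of the Lefschetz data exists** (already on `ℝ³`).  Compare
`riemannHypothesis_iff_nonempty_weilSurface`: by item 2 the Riemann–Roch datum of a Weil surface can
always be replaced by the `ℙ¹ × ℙ¹` count, so what the strategy must construct is a carrier on which
the decreed pairing has positive index one — the located object is a Hodge-index certificate. -/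
theorem riemannHypothesis_iff_exists_hodge_lefschetz_data :
    RiemannHypothesis ↔ ∃ (I : LinearMap.BilinForm ℝ (ℝ × ℝ × ℝ)) (e₁ e₂ : ℝ × ℝ × ℝ)
      (corr : (ℝ → ℂ) → ℝ × ℝ × ℝ),
      (∀ x y, I x y = I y x) ∧ I e₁ e₁ = 0 ∧ I e₂ e₂ = 0 ∧ I e₁ e₂ = 1 ∧
      (∀ g, IsWeilTest g → (∀ t, conj (g t) = g t) → I (corr g) e₁ = (weilMellin g 1).re) ∧
      (∀ g, IsWeilTest g → (∀ t, conj (g t) = g t) → I (corr g) e₂ = (weilMellin g 0).re) ∧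
      (∀ g, IsWeilTest g → (∀ t, conj (g t) = g t) →
        I (corr g) (corr g) = 2 * (weilMellin g 0).re * (weilMellin g 1).re - (weilQuadratic g).re) ∧
      ∀ D, I D (e₁ + e₂) = 0 → I D D ≤ 0 := by
  constructor
  · intro hRH
    let X := WeilSurface.model hRH
    exact ⟨X.inter, X.e₁, X.e₂, X.corr, X.inter_comm, X.inter_e₁_e₁, X.inter_e₂_e₂, X.inter_e₁_e₂,
      X.inter_corr_e₁, X.inter_corr_e₂, X.inter_corr_self, fun D hD ↦ X.inter_self_nonpos hD⟩
  · rintro ⟨I, e₁, e₂, corr, hI, h₁, h₂, h₁₂, hc₁, hc₂, hcs, hodge⟩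
    exact riemannHypothesis_of_hodge I hI h₁ h₂ h₁₂ corr hc₁ hc₂ hcs hodge

end Summit.RiemannHypothesis.RiemannHypothesis.Theorems.MotivicDoor.ConnesConsani
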